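import Mathlib.Topology.Algebra.Group.Units
import Mathlib.Topology.Algebra.Nonarchimedean.Basic
import Mathlib.Topology.Algebra.OpenSubgroup
import Mathlib.Topology.Algebra.Ring.Basic
import Mathlib.Topology.Algebra.Valued.ValuationTopology
import Mathlib.RingTheory.DedekindDomain.AdicValuation
import HarnessLib

/-!
# Units of valuation rings, and their products, are nonarchimedean groups

Topic `Topology/Algebra`; namespace `Literature.Topology.Algebra` (grouping sub-namespaces `Units`,
`Valued`, `IsDedekindDomain.HeightOneSpectrum` after the objects). A topological group is
NONARCHIMEDEAN (Mathlib `NonarchimedeanGroup`) if every neighbourhood of `1` contains an open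
subgroup. This file supplies the instances used for idele class groups:

* `Units.nonarchimedeanGroup_of_openSubmonoid_basis` — if every neighbourhood of `1` in a
  topological monoid `M` contains an OPEN SUBMONOID, then `Mˣ` (units topology, via
  `Units.embedProduct`) is a nonarchimedean group (open subgroups `W.units`);
* `Pi.instNonarchimedeanGroup` — products of nonarchimedean groups are nonarchimedean (Mathlib
  has the binary `Prod.instNonarchimedeanGroup` only); `NonarchimedeanGroup.of_continuousMulEquiv`;
* `Valued.unitBall γ = {x ∈ 𝒪 | v (x - 1) < γ}`, an open submonoid of the valuation ring `𝒪` of a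
  valued field, and `Valued.instNonarchimedeanGroupUnitsValuationSubring` — **`𝒪ˣ` is a
  nonarchimedean group**;
* for a Dedekind domain `R` with fraction field `K` and a finite place `v`:
  `IsTopologicalRing (v.adicCompletionIntegers K)`,
  `NonarchimedeanGroup (v.adicCompletionIntegers K)ˣ` and
  `NonarchimedeanGroup (Π w, w.adicCompletionIntegers K)ˣ` (via `ContinuousMulEquiv.piUnits`).

Standard (N. Bourbaki, *Commutative Algebra*, Ch. VI §5; J. W. S. Cassels, "Global fields", in
Cassels–Fröhlich (1967), Ch. II §§1–2 [CasselsFrohlichANT1967]); everything is proved (Mathlib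
only). The instances are new
(`lean search --decl 'NonarchimedeanGroup .*(adicCompletion|valuationSubring|Units)'`: nothing in
Mathlib or the tree).

## Provenance

Reproduced for the tree under the LEAN-IN-TREE rule (2026-08-18) from the pub-hodgecm cell's
package file `HodgeCM/PerL34/UnitsNonarchimedean.lean` (DAG-node prover #10 lineage, seat pv10,
gate run 20; 187 lines), verbatim up to the enclosing namespace and the added docstrings / tags.
-/

noncomputable section

open _root_.Topology Filter Set

namespace Literature.Topology.Algebra

/-! ## Units of a monoid with a basis of open submonoids -/

namespace Units

/-- If every neighbourhood of `1` in a topological monoid contains an open submonoid, the group of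
units (with its units topology) is a nonarchimedean group: the open subgroups are `W.units` for the
open submonoids `W`. [folklore] -/
theorem nonarchimedeanGroup_of_openSubmonoid_basis {M : Type*} [Monoid M] [TopologicalSpace M]
    [ContinuousMul M]
    (h : ∀ N ∈ 𝓝 (1 : M), ∃ W : Submonoid M, IsOpen (W : Set M) ∧ (W : Set M) ⊆ N) :
    NonarchimedeanGroup Mˣ where
  is_nonarchimedean U hU := by
    rw [_root_.Units.isInducing_embedProduct.nhds_eq_comap (1 : Mˣ), Filter.mem_comap] at hU
    obtain ⟨S, hS, hSU⟩ := hU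
    have hS' : S ∈ 𝓝 ((1 : M), MulOpposite.op (1 : M)) := by
      simpa [_root_.Units.embedProduct] using hS
    obtain ⟨N₁, hN₁, N₂, hN₂, hprod⟩ := mem_nhds_prod_iff.mp hS'
    have hN₂' : MulOpposite.op ⁻¹' N₂ ∈ 𝓝 (1 : M) :=
      MulOpposite.continuous_op.continuousAt.preimage_mem_nhds hN₂
    obtain ⟨W, hWo, hWN⟩ := h _ (Filter.inter_mem hN₁ hN₂')
    refine ⟨⟨W.units, Submonoid.isOpen_units hWo⟩, ?_⟩
    intro u hu
    have hu' : (u : M) ∈ W ∧ ((u⁻¹ : Mˣ) : M) ∈ W := (Submonoid.mem_units_iff W u).mp hu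
    apply hSU
    show _root_.Units.embedProduct M u ∈ S
    exact hprod (Set.mk_mem_prod (hWN hu'.1).1 (hWN hu'.2).2)

end Units

/-! ## Products -/

/-- **Products of nonarchimedean groups are nonarchimedean** (a neighbourhood of `1` in `Π i, G i`
contains a finite intersection of pulled-back open subgroups). [folklore] -/
instance Pi.instNonarchimedeanGroup {ι : Type*} {G : ι → Type*} [∀ i, Group (G i)]
    [∀ i, TopologicalSpace (G i)] [∀ i, NonarchimedeanGroup (G i)] :
    NonarchimedeanGroup (∀ i, G i) where
  is_nonarchimedean U hU := by
    rw [nhds_pi, Filter.mem_pi] at hU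
    obtain ⟨I, hI, t, ht, hts⟩ := hU
    choose V hV using fun i => NonarchimedeanGroup.is_nonarchimedean (t i) (ht i)
    refine ⟨hI.toFinset.inf fun i => (V i).comap (Pi.evalMonoidHom G i) (continuous_apply i), ?_⟩
    intro x hx
    apply hts
    intro i hi
    apply hV i
    have hle : (hI.toFinset.inf fun i => (V i).comap (Pi.evalMonoidHom G i) (continuous_apply i)) ≤
        (V i).comap (Pi.evalMonoidHom G i) (continuous_apply i) :=
      Finset.inf_le (hI.mem_toFinset.mpr hi)
    exact OpenSubgroup.mem_comap.mp (hle hx)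

/-- A topological group isomorphic (as a topological group) to a nonarchimedean group is
nonarchimedean. [folklore] -/
theorem NonarchimedeanGroup.of_continuousMulEquiv {G H : Type*} [Group G] [TopologicalSpace G]
    [NonarchimedeanGroup G] [Group H] [TopologicalSpace H] [IsTopologicalGroup H] (e : G ≃ₜ* H) :
    NonarchimedeanGroup H :=
  NonarchimedeanGroup.nonarchimedean_of_emb e.toMonoidHom e.toHomeomorph.isOpenEmbedding

/-! ## Units of the valuation ring of a valued field -/

namespace Valued

variable {R : Type*} [Field R] {Γ₀ : Type*} [LinearOrderedCommGroupWithZero Γ₀] [hv : Valued R Γ₀]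

/-- The valuation ring `𝒪` of a valued field is a topological ring (subspace topology).
[folklore] -/
instance instIsTopologicalRingValuationSubring :
    IsTopologicalRing (hv.v.valuationSubring : ValuationSubring R) :=
  inferInstanceAs (IsTopologicalRing (hv.v.valuationSubring : ValuationSubring R).toSubring)

/-- The submonoid `{x ∈ 𝒪 | v (x - 1) < γ}` of the valuation ring (`γ` a unit of the value
group); it is open (`isOpen_unitBall`). [folklore] -/
def unitBall (γ : (MonoidWithZeroHom.ValueGroup₀ (.ofClass (hv.v : Valuation R Γ₀)))ˣ) :
    Submonoid (hv.v.valuationSubring : ValuationSubring R) where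
  carrier := {x | hv.v.restrict ((x : R) - 1) < γ}
  one_mem' := by
    simp only [Set.mem_setOf_eq, OneMemClass.coe_one, sub_self, map_zero]
    exact γ.zero_lt
  mul_mem' := by
    intro x y hx hy
    simp only [Set.mem_setOf_eq] at hx hy ⊢
    have hy1 : hv.v.restrict (y : R) ≤ 1 :=
      (Valuation.restrict_le_one_iff _).mpr ((Valuation.mem_valuationSubring_iff _ _).mp y.2)
    have h1 : hv.v.restrict (((x : R) - 1) * (y : R)) < γ := by
      rw [map_mul]
      calc hv.v.restrict ((x : R) - 1) * hv.v.restrict (y : R)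
          ≤ hv.v.restrict ((x : R) - 1) * 1 := by gcongr
        _ = hv.v.restrict ((x : R) - 1) := mul_one _
        _ < γ := hx
    have h := Valuation.map_add_lt _ h1 hy
    have heq : ((x : R) - 1) * (y : R) + ((y : R) - 1) = (x : R) * (y : R) - 1 := by ring
    rw [heq] at h
    simpa using h

/-- Membership in `unitBall γ`. [folklore] -/
theorem mem_unitBall {γ : (MonoidWithZeroHom.ValueGroup₀ (.ofClass (hv.v : Valuation R Γ₀)))ˣ}
    {x : (hv.v.valuationSubring : ValuationSubring R)} :
    x ∈ unitBall γ ↔ hv.v.restrict ((x : R) - 1) < γ := Iff.rfl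

/-- `{r | v (r - 1) < γ}` is open in a valued field. [folklore] -/
theorem isOpen_setOf_sub_one_lt
    (γ : (MonoidWithZeroHom.ValueGroup₀ (.ofClass (hv.v : Valuation R Γ₀)))ˣ) :
    IsOpen {r : R | hv.v.restrict (r - 1) < γ} := by
  rw [isOpen_iff_mem_nhds]
  intro r hr
  rw [Valued.mem_nhds]
  refine ⟨γ, fun y hy => ?_⟩
  simp only [Set.mem_setOf_eq] at hr hy ⊢
  have h := Valuation.map_add_lt _ hy hr
  have heq : y - r + (r - 1) = y - 1 := by ring
  rwa [heq] at h

/-- `unitBall γ` is open in `𝒪`. [folklore] -/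
theorem isOpen_unitBall (γ : (MonoidWithZeroHom.ValueGroup₀ (.ofClass (hv.v : Valuation R Γ₀)))ˣ) :
    IsOpen (unitBall γ : Set (hv.v.valuationSubring : ValuationSubring R)) :=
  (isOpen_setOf_sub_one_lt γ).preimage continuous_subtype_val

/-- Every neighbourhood of `1` in `𝒪` contains some `unitBall γ`. [folklore] -/
theorem exists_unitBall_subset {N : Set (hv.v.valuationSubring : ValuationSubring R)}
    (hN : N ∈ 𝓝 (1 : (hv.v.valuationSubring : ValuationSubring R))) :
    ∃ γ : (MonoidWithZeroHom.ValueGroup₀ (.ofClass (hv.v : Valuation R Γ₀)))ˣ,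
      (unitBall γ : Set (hv.v.valuationSubring : ValuationSubring R)) ⊆ N := by
  rw [nhds_subtype, Filter.mem_comap] at hN
  obtain ⟨N', hN', hsub⟩ := hN
  rw [OneMemClass.coe_one, Valued.mem_nhds] at hN'
  obtain ⟨γ, hγ⟩ := hN'
  exact ⟨γ, fun x hx => hsub (hγ hx)⟩

/-- **`𝒪ˣ` is a nonarchimedean group**: the unit group of the valuation ring of a valued field,
with its units topology, has a neighbourhood basis of `1` of open subgroups `(unitBall γ).units`.
[cite: CasselsFrohlichANT1967, Ch. II §2] -/
instance instNonarchimedeanGroupUnitsValuationSubring :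
    NonarchimedeanGroup (hv.v.valuationSubring : ValuationSubring R)ˣ :=
  Units.nonarchimedeanGroup_of_openSubmonoid_basis fun N hN => by
    obtain ⟨γ, hγ⟩ := exists_unitBall_subset hN
    exact ⟨unitBall γ, isOpen_unitBall γ, hγ⟩

end Valued

/-! ## `𝒪_v^×` and `∏_v 𝒪_v^×` for a Dedekind domain -/

namespace IsDedekindDomain.HeightOneSpectrum

variable (R : Type*) [CommRing R] [IsDedekindDomain R] (K : Type*) [Field K] [Algebra R K]
  [IsFractionRing R K] (v : _root_.IsDedekindDomain.HeightOneSpectrum R)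

/-- `𝒪_v = v.adicCompletionIntegers K` is a topological ring. [folklore] -/
instance instIsTopologicalRingAdicCompletionIntegers :
    IsTopologicalRing (v.adicCompletionIntegers K) :=
  Valued.instIsTopologicalRingValuationSubring

/-- `𝒪_vˣ` is a nonarchimedean group, for a finite place `v` of a Dedekind domain.
[cite: CasselsFrohlichANT1967, Ch. II §2] -/
instance instNonarchimedeanGroupUnitsAdicCompletionIntegers :
    NonarchimedeanGroup (v.adicCompletionIntegers K)ˣ :=
  Valued.instNonarchimedeanGroupUnitsValuationSubring

/-- `(∏_v 𝒪_v)ˣ ≅ ∏_v 𝒪_vˣ` is a nonarchimedean group. [folklore] -/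
instance instNonarchimedeanGroupUnitsPiAdicCompletionIntegers :
    NonarchimedeanGroup (Π w : _root_.IsDedekindDomain.HeightOneSpectrum R,
      w.adicCompletionIntegers K)ˣ :=
  NonarchimedeanGroup.of_continuousMulEquiv
    (ContinuousMulEquiv.piUnits
      (M := fun w : _root_.IsDedekindDomain.HeightOneSpectrum R => w.adicCompletionIntegers K)).symm

end IsDedekindDomain.HeightOneSpectrum

end Literature.Topology.Algebra

end
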